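import Summits.CriticalPhenomena.PercolationContinuityZ3.Theorems.PercNearOneGluingNoHeavyLowerTailSahiOneStepSubblockThresholdFree
import Summits.CriticalPhenomena.PercolationContinuityZ3.Theorems.PercNearOneGluingNoHeavyLowerTailSahiOneStepThresholdsMLR
import HarnessLib

/-!
# One-step scheme: the LAYER CRITERION for the `(2′)` half of a Hamming-threshold slot, every product measure

Support file (prover prim-ineq-prove-3 gen 30; `--supports stmt-CriticalPhenomena-4575`; memo
`run/shared/lean/prim/prim-ineq-prove-3/FINDING-G30-SHIFTED-PAIRS.md` §1).  No definitions, no named facts, no sorries, no `native_decide`.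

For the slot `H = Th_t(F) = {ω | t ≤ #(F ∩ ω)}`, `L = Hᶜ`, and increasing events `A, B`, the `(2′)` functional of `…SahiOneStepDefs`
(`n(1_A,1_B) ≥ 0` ⟺ `Cov(A,B) ≥ μ(L)·Cov(A,B ∣ L)`) has the LAYER NORMAL FORM
`n(1_A,1_B) = μ(L)·[ Σ_{k ≥ t} μ(N_F=k)·Cov(1_A,1_B ∣ N_F=k) + Cov_π(φ♭,γ♭) ]`, where `φ_k = μ(A ∣ N_F = k)` is nondecreasing in `k`
(layer monotonicity, `real_inter_inter_layer_mul_le`) and `φ♭` is `φ` with the values below `t` replaced by their average (still nondecreasing),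
so the second term is nonnegative by Chebyshev's sum inequality on the chain `{0,…,|F|}`.  Hence:

* `layerGrid_nonneg` — the division-free 1-D inequality behind this (weights `π`, layer masses `α, β, γ` with the MLR relations of layer
  monotonicity and the layerwise hypothesis `α_k β_k ≤ γ_k π_k` for `k ≥ t`);
* **`osN_threshold_nonneg_of_layerPos` (LAYER CRITERION):** if `μ(A ∩ N_k)·μ(B ∩ N_k) ≤ μ(A ∩ B ∩ N_k)·μ(N_k)` for every `k ≥ t`
  (`A` and `B` nonnegatively correlated on every high layer of `F`), then `0 ≤ n(Th_t(F); 1_A, 1_B)` for EVERY density vector; with the `(3′)` half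
  (`osMp_threshold_nonneg_all`) this gives **`sahiE3_threshold_nonneg_of_layerPos`**: `0 ≤ E₃(1_{Th_t(F)}, 1_A, 1_B)`;
* first instances: `osN_threshold_nonneg_of_subset` / `sahiE3_threshold_nonneg_of_subset` (nested pairs `A ⊆ B`).
The companion file `…SahiOneStepGaleFKG` supplies the hypothesis for pairs of events shifted in the same direction (FKG on the Gale lattice of a layer).
-/

noncomputable section

namespace Summit.CriticalPhenomena.PercolationContinuityZ3.Theorems

namespace SahiOneStep

open MeasureTheory Finset
open Literature.Probability.Percolation (DeterminedBy determinedBy_iff)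
open Literature.Probability.LatticeModels (prodBernoulli sahiE3)
open Literature.Probability.Percolation.DecisionTree (ind)
open scoped Classical

variable {ι : Type*} [Fintype ι] [DecidableEq ι]

/-! ## §1 The 1-D inequality (chain `{0,…,m}`, division-free hypotheses) -/

omit [Fintype ι] [DecidableEq ι] in
/-- **The layer grid inequality.**  Let `π, α, β, γ ≥ 0` on `{0,…,m}` with `α, β ≤ π`, `Σ π = 1`, the MLR relations `α_j π_k ≤ α_k π_j`,
`β_j π_k ≤ β_k π_j` (`j ≤ k`) and the high-layer hypothesis `α_k β_k ≤ γ_k π_k` (`t ≤ k`).  Then the `H`-form of the `(2′)` functional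
(`osN_ind_ind` with `μ(H∩A) = Σ_{k≥t} α_k`, `μ(H∩A∩B) = Σ_{k≥t} γ_k`, `μA = Σ α_k`, …) is nonnegative. [this work] -/
theorem layerGrid_nonneg (m t : ℕ) (π α β γ : ℕ → ℝ) (hπ : ∀ k, 0 ≤ π k) (hα : ∀ k, 0 ≤ α k) (hβ : ∀ k, 0 ≤ β k) (hγ : ∀ k, 0 ≤ γ k)
    (hαπ : ∀ k, α k ≤ π k) (hβπ : ∀ k, β k ≤ π k) (hπ1 : ∑ k ∈ range (m + 1), π k = 1)
    (mlrA : ∀ j k, j ≤ k → α j * π k ≤ α k * π j) (mlrB : ∀ j k, j ≤ k → β j * π k ≤ β k * π j)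
    (hpos : ∀ k, t ≤ k → α k * β k ≤ γ k * π k) :
    0 ≤ (∑ k ∈ range (m + 1), if t ≤ k then α k else 0) * (∑ k ∈ range (m + 1), if t ≤ k then β k else 0)
        + (1 - ∑ k ∈ range (m + 1), if t ≤ k then π k else 0) * (∑ k ∈ range (m + 1), if t ≤ k then γ k else 0)
        + (∑ k ∈ range (m + 1), if t ≤ k then π k else 0) * (∑ k ∈ range (m + 1), α k) * (∑ k ∈ range (m + 1), β k)
        - (∑ k ∈ range (m + 1), if t ≤ k then α k else 0) * (∑ k ∈ range (m + 1), β k)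
        - (∑ k ∈ range (m + 1), if t ≤ k then β k else 0) * (∑ k ∈ range (m + 1), α k) := by
  -- low / high splits
  set ℓ : ℝ := ∑ k ∈ range (m + 1), if t ≤ k then 0 else π k with hℓ
  set aL : ℝ := ∑ k ∈ range (m + 1), if t ≤ k then 0 else α k with haL
  set bL : ℝ := ∑ k ∈ range (m + 1), if t ≤ k then 0 else β k with hbL
  set aH : ℝ := ∑ k ∈ range (m + 1), if t ≤ k then α k else 0 with haH
  set bH : ℝ := ∑ k ∈ range (m + 1), if t ≤ k then β k else 0 with hbH
  set hH : ℝ := ∑ k ∈ range (m + 1), if t ≤ k then π k else 0 with hhH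
  set G : ℝ := ∑ k ∈ range (m + 1), if t ≤ k then γ k else 0 with hG
  have splitπ : hH + ℓ = 1 := by
    rw [hhH, hℓ, ← Finset.sum_add_distrib, ← hπ1]
    exact Finset.sum_congr rfl fun k _ => by split_ifs <;> simp
  have splitα : (∑ k ∈ range (m + 1), α k) = aH + aL := by
    rw [haH, haL, ← Finset.sum_add_distrib]
    exact Finset.sum_congr rfl fun k _ => by split_ifs <;> simp
  have splitβ : (∑ k ∈ range (m + 1), β k) = bH + bL := by
    rw [hbH, hbL, ← Finset.sum_add_distrib]
    exact Finset.sum_congr rfl fun k _ => by split_ifs <;> simp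
  have hℓ0 : 0 ≤ ℓ := Finset.sum_nonneg fun k _ => by split_ifs; exacts [le_rfl, hπ k]
  have haL0 : 0 ≤ aL := Finset.sum_nonneg fun k _ => by split_ifs; exacts [le_rfl, hα k]
  have hbL0 : 0 ≤ bL := Finset.sum_nonneg fun k _ => by split_ifs; exacts [le_rfl, hβ k]
  have hG0 : 0 ≤ G := Finset.sum_nonneg fun k _ => by split_ifs; exacts [hγ k, le_rfl]
  -- the target is `aL bL + ℓ G − ℓ a b`
  have key : 0 ≤ aL * bL + ℓ * G - ℓ * ((aH + aL) * (bH + bL)) := by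
    by_cases hℓz : ℓ = 0
    · -- then every low layer is null, so `aL = bL = 0`
      have hπlow : ∀ k ∈ range (m + 1), ¬ t ≤ k → π k = 0 := by
        intro k hk hkt
        have h1 : (if t ≤ k then (0:ℝ) else π k) ≤ ℓ :=
          Finset.single_le_sum (f := fun k => if t ≤ k then (0:ℝ) else π k) (fun k _ => by split_ifs; exacts [le_rfl, hπ k]) hk
        rw [if_neg hkt, hℓz] at h1
        exact le_antisymm h1 (hπ k)
      have haLz : aL = 0 := by
        rw [haL]; refine Finset.sum_eq_zero fun k hk => ?_
        split_ifs with hkt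
        · rfl
        · exact le_antisymm ((hαπ k).trans (hπlow k hk hkt).le) (hα k)
      have hbLz : bL = 0 := by
        rw [hbL]; refine Finset.sum_eq_zero fun k hk => ?_
        split_ifs with hkt
        · rfl
        · exact le_antisymm ((hβπ k).trans (hπlow k hk hkt).le) (hβ k)
      rw [haLz, hbLz, hℓz]; simp
    · have hℓpos : 0 < ℓ := lt_of_le_of_ne hℓ0 (Ne.symm hℓz)
      -- lumped layer profiles
      set φ : ℕ → ℝ := fun k => if t ≤ k then α k / π k else aL / ℓ with hφ
      set ψ : ℕ → ℝ := fun k => if t ≤ k then β k / π k else bL / ℓ with hψ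
      have hπφ : ∀ k, π k * φ k = if t ≤ k then α k else π k * (aL / ℓ) := by
        intro k; rw [hφ]; dsimp only
        split_ifs with hkt
        · by_cases hπk : π k = 0
          · have : α k = 0 := le_antisymm ((hαπ k).trans hπk.le) (hα k)
            rw [hπk, this]; simp
          · field_simp
        · rfl
      have hπψ : ∀ k, π k * ψ k = if t ≤ k then β k else π k * (bL / ℓ) := by
        intro k; rw [hψ]; dsimp only
        split_ifs with hkt
        · by_cases hπk : π k = 0
          · have : β k = 0 := le_antisymm ((hβπ k).trans hπk.le) (hβ k)
            rw [hπk, this]; simp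
          · field_simp
        · rfl
      have hπφψ : ∀ k, π k * φ k * ψ k ≤ if t ≤ k then γ k else π k * (aL / ℓ) * (bL / ℓ) := by
        intro k; rw [hφ, hψ]; dsimp only
        split_ifs with hkt
        · by_cases hπk : π k = 0
          · have : α k = 0 := le_antisymm ((hαπ k).trans hπk.le) (hα k)
            rw [hπk, this]; simp [hγ k]
          · have hπkpos : 0 < π k := lt_of_le_of_ne (hπ k) (Ne.symm hπk)
            rw [show π k * (α k / π k) * (β k / π k) = α k * β k / π k by field_simp]
            rw [div_le_iff₀ hπkpos]
            exact hpos k hkt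
        · exact le_rfl
      -- sums of the lumped profiles
      have sφ : (∑ k ∈ range (m + 1), π k * φ k) = aH + aL := by
        rw [Finset.sum_congr rfl fun k _ => hπφ k]
        have : (∑ k ∈ range (m + 1), if t ≤ k then α k else π k * (aL / ℓ)) =
            aH + (∑ k ∈ range (m + 1), if t ≤ k then 0 else π k) * (aL / ℓ) := by
          rw [haH, Finset.sum_mul, ← Finset.sum_add_distrib]
          exact Finset.sum_congr rfl fun k _ => by split_ifs <;> simp
        rw [this, ← hℓ]; field_simp
      have sψ : (∑ k ∈ range (m + 1), π k * ψ k) = bH + bL := by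
        rw [Finset.sum_congr rfl fun k _ => hπψ k]
        have : (∑ k ∈ range (m + 1), if t ≤ k then β k else π k * (bL / ℓ)) =
            bH + (∑ k ∈ range (m + 1), if t ≤ k then 0 else π k) * (bL / ℓ) := by
          rw [hbH, Finset.sum_mul, ← Finset.sum_add_distrib]
          exact Finset.sum_congr rfl fun k _ => by split_ifs <;> simp
        rw [this, ← hℓ]; field_simp
      have sφψ : (∑ k ∈ range (m + 1), π k * φ k * ψ k) ≤ G + aL * bL / ℓ := by
        refine (Finset.sum_le_sum fun k _ => hπφψ k).trans (le_of_eq ?_)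
        have : (∑ k ∈ range (m + 1), if t ≤ k then γ k else π k * (aL / ℓ) * (bL / ℓ)) =
            G + (∑ k ∈ range (m + 1), if t ≤ k then 0 else π k) * (aL / ℓ) * (bL / ℓ) := by
          rw [hG, Finset.sum_mul, Finset.sum_mul, ← Finset.sum_add_distrib]
          exact Finset.sum_congr rfl fun k _ => by split_ifs <;> simp
        rw [this, ← hℓ]; field_simp
      -- comonotonicity of the lumped profiles on the support of `π`
      have lowφ : ∀ k, t ≤ k → π k ≠ 0 → aL / ℓ ≤ α k / π k := by
        intro k hkt hπk
        have hπkpos : 0 < π k := lt_of_le_of_ne (hπ k) (Ne.symm hπk)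
        rw [div_le_div_iff₀ hℓpos hπkpos, haL, hℓ, Finset.sum_mul, Finset.mul_sum]
        refine Finset.sum_le_sum fun j hj => ?_
        split_ifs with hjt
        · simp
        · have hjk : j ≤ k := by omega
          rw [mul_comm (α k)]
          linarith [mlrA j k hjk]
      have lowψ : ∀ k, t ≤ k → π k ≠ 0 → bL / ℓ ≤ β k / π k := by
        intro k hkt hπk
        have hπkpos : 0 < π k := lt_of_le_of_ne (hπ k) (Ne.symm hπk)
        rw [div_le_div_iff₀ hℓpos hπkpos, hbL, hℓ, Finset.sum_mul, Finset.mul_sum]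
        refine Finset.sum_le_sum fun j hj => ?_
        split_ifs with hjt
        · simp
        · have hjk : j ≤ k := by omega
          rw [mul_comm (β k)]
          linarith [mlrB j k hjk]
      have monoφ : ∀ j k, j ≤ k → π j ≠ 0 → π k ≠ 0 → φ j ≤ φ k := by
        intro j k hjk hπj hπk
        have hπjpos : 0 < π j := lt_of_le_of_ne (hπ j) (Ne.symm hπj)
        have hπkpos : 0 < π k := lt_of_le_of_ne (hπ k) (Ne.symm hπk)
        rw [hφ]; dsimp only
        by_cases hjt : t ≤ j
        · rw [if_pos hjt, if_pos (hjt.trans hjk), div_le_div_iff₀ hπjpos hπkpos]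
          exact mlrA j k hjk
        · rw [if_neg hjt]
          by_cases hkt : t ≤ k
          · rw [if_pos hkt]; exact lowφ k hkt hπk
          · rw [if_neg hkt]
      have monoψ : ∀ j k, j ≤ k → π j ≠ 0 → π k ≠ 0 → ψ j ≤ ψ k := by
        intro j k hjk hπj hπk
        have hπjpos : 0 < π j := lt_of_le_of_ne (hπ j) (Ne.symm hπj)
        have hπkpos : 0 < π k := lt_of_le_of_ne (hπ k) (Ne.symm hπk)
        rw [hψ]; dsimp only
        by_cases hjt : t ≤ j
        · rw [if_pos hjt, if_pos (hjt.trans hjk), div_le_div_iff₀ hπjpos hπkpos]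
          exact mlrB j k hjk
        · rw [if_neg hjt]
          by_cases hkt : t ≤ k
          · rw [if_pos hkt]; exact lowψ k hkt hπk
          · rw [if_neg hkt]
      -- Chebyshev on the chain
      have cheb := ThreshGrid.sum_mul_sum_ge_of_pairs' (m + 1) π φ ψ hπ (fun j k hjk _ hπj hπk =>
        mul_nonneg_of_nonpos_of_nonpos (sub_nonpos.2 (monoφ j k hjk.le hπj hπk)) (sub_nonpos.2 (monoψ j k hjk.le hπj hπk)))
      rw [hπ1, one_mul, sφ, sψ] at cheb
      have h3 : (aH + aL) * (bH + bL) ≤ G + aL * bL / ℓ := cheb.trans sφψ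
      have h4 : ℓ * ((aH + aL) * (bH + bL)) ≤ ℓ * G + aL * bL := by
        have h5 := mul_le_mul_of_nonneg_left h3 hℓ0
        have e : ℓ * (G + aL * bL / ℓ) = ℓ * G + aL * bL := by field_simp
        linarith [h5, e]
      linarith
  -- rewrite the target in terms of the splits
  have hhH' : hH = 1 - ℓ := by linarith [splitπ]
  rw [splitα, splitβ, hhH']
  nlinarith [key]

/-! ## §2 Layers of the block `F` -/

omit [DecidableEq ι] in
/-- **Layer decomposition of a measure**: `μ(E) = Σ_{k ≤ |F|} μ(E ∩ {N_F = k})`. [folklore] -/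
theorem real_eq_sum_layers (p : ι → unitInterval) (F : Finset ι) (E : Set (Set ι)) :
    (prodBernoulli p).real E = ∑ k ∈ range (F.card + 1), (prodBernoulli p).real (E ∩ {ω : Set ι | (F.filter (· ∈ ω)).card = k}) := by
  rw [real_eq_sum_cells p F ∅ E]
  refine Finset.sum_congr rfl fun k _ => ?_
  rw [Finset.card_empty, zero_add, Finset.sum_range_one]
  congr 1
  ext ω
  simp only [Set.mem_inter_iff, Set.mem_setOf_eq, Finset.filter_empty, Finset.card_empty, and_true]

omit [Fintype ι] [DecidableEq ι] in
/-- On a layer the threshold slot is decided: `μ(Th_t ∩ E ∩ {N_F = k}) = [t ≤ k]·μ(E ∩ {N_F = k})`. [folklore] -/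
theorem real_threshold_inter_layer (p : ι → unitInterval) (F : Finset ι) (t k : ℕ) (E : Set (Set ι)) :
    (prodBernoulli p).real ({ω : Set ι | t ≤ (F.filter (· ∈ ω)).card} ∩ E ∩ {ω : Set ι | (F.filter (· ∈ ω)).card = k}) =
      if t ≤ k then (prodBernoulli p).real (E ∩ {ω : Set ι | (F.filter (· ∈ ω)).card = k}) else 0 := by
  by_cases hk : t ≤ k
  · rw [if_pos hk]
    congr 1
    ext ω
    simp only [Set.mem_inter_iff, Set.mem_setOf_eq]
    constructor
    · rintro ⟨⟨_, hE⟩, hc⟩; exact ⟨hE, hc⟩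
    · rintro ⟨hE, hc⟩; exact ⟨⟨hc ▸ hk, hE⟩, hc⟩
  · rw [if_neg hk]
    have : ({ω : Set ι | t ≤ (F.filter (· ∈ ω)).card} ∩ E ∩ {ω : Set ι | (F.filter (· ∈ ω)).card = k}) = ∅ := by
      ext ω
      simp only [Set.mem_inter_iff, Set.mem_setOf_eq, Set.mem_empty_iff_false, iff_false, not_and]
      intro h hc; rw [hc] at h; exact hk h.1
    rw [this, measureReal_empty]

/-! ## §3 The layer criterion -/

omit [DecidableEq ι] in
/-- **THE LAYER CRITERION for `(2′)`.**  For every product measure, every block `F`, threshold `t` and increasing events `A, B`: if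
`μ(A ∩ {N_F=k})·μ(B ∩ {N_F=k}) ≤ μ(A ∩ B ∩ {N_F=k})·μ{N_F=k}` for all `k ≥ t` (nonnegative correlation on every high layer of `F`), then
`0 ≤ n(Th_t(F); 1_A, 1_B)`, i.e. `Cov(1_A,1_B) ≥ μ(N_F < t)·Cov(1_A,1_B ∣ N_F < t)`. [this work] -/
theorem osN_threshold_nonneg_of_layerPos (p : ι → unitInterval) (F : Finset ι) (t : ℕ) {A B : Set (Set ι)}
    (hA : IsUpperSet A) (hB : IsUpperSet B)
    (hpos : ∀ k, t ≤ k →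
      (prodBernoulli p).real (A ∩ {ω : Set ι | (F.filter (· ∈ ω)).card = k}) *
          (prodBernoulli p).real (B ∩ {ω : Set ι | (F.filter (· ∈ ω)).card = k}) ≤
        (prodBernoulli p).real (A ∩ B ∩ {ω : Set ι | (F.filter (· ∈ ω)).card = k}) *
          (prodBernoulli p).real {ω : Set ι | (F.filter (· ∈ ω)).card = k}) :
    0 ≤ osN p {ω : Set ι | t ≤ (F.filter (· ∈ ω)).card} (ind A) (ind B) := by
  set μ := prodBernoulli p with hμ
  set H : Set (Set ι) := {ω : Set ι | t ≤ (F.filter (· ∈ ω)).card} with hH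
  -- layer data
  obtain ⟨π, hπ⟩ : ∃ π : ℕ → ℝ, ∀ k, π k = μ.real {ω : Set ι | (F.filter (· ∈ ω)).card = k} := ⟨_, fun _ => rfl⟩
  obtain ⟨α, hα⟩ : ∃ α : ℕ → ℝ, ∀ k, α k = μ.real (A ∩ {ω : Set ι | (F.filter (· ∈ ω)).card = k}) := ⟨_, fun _ => rfl⟩
  obtain ⟨β, hβ⟩ : ∃ β : ℕ → ℝ, ∀ k, β k = μ.real (B ∩ {ω : Set ι | (F.filter (· ∈ ω)).card = k}) := ⟨_, fun _ => rfl⟩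
  obtain ⟨γ, hγ⟩ : ∃ γ : ℕ → ℝ, ∀ k, γ k = μ.real (A ∩ B ∩ {ω : Set ι | (F.filter (· ∈ ω)).card = k}) := ⟨_, fun _ => rfl⟩
  have hπ0 : ∀ k, 0 ≤ π k := fun k => by rw [hπ]; exact measureReal_nonneg
  have hα0 : ∀ k, 0 ≤ α k := fun k => by rw [hα]; exact measureReal_nonneg
  have hβ0 : ∀ k, 0 ≤ β k := fun k => by rw [hβ]; exact measureReal_nonneg
  have hγ0 : ∀ k, 0 ≤ γ k := fun k => by rw [hγ]; exact measureReal_nonneg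
  have hαπ : ∀ k, α k ≤ π k := fun k => by rw [hα, hπ]; exact measureReal_mono Set.inter_subset_right
  have hβπ : ∀ k, β k ≤ π k := fun k => by rw [hβ, hπ]; exact measureReal_mono Set.inter_subset_right
  have hπ1 : ∑ k ∈ range (F.card + 1), π k = 1 := by
    rw [Finset.sum_congr rfl fun k _ => hπ k]; exact sum_real_layer_eq_one p F
  have huniv : DeterminedBy (Set.univ : Set (Set ι)) ((↑F : Set ι)ᶜ) := by
    rw [determinedBy_iff]; intro ω ω' _; simp
  have mlrA : ∀ j k, j ≤ k → α j * π k ≤ α k * π j := fun j k hjk => by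
    have h := real_inter_inter_layer_mul_le p F hA huniv hjk
    rw [Set.inter_univ] at h
    rw [hα, hα, hπ, hπ]; exact h
  have mlrB : ∀ j k, j ≤ k → β j * π k ≤ β k * π j := fun j k hjk => by
    have h := real_inter_inter_layer_mul_le p F hB huniv hjk
    rw [Set.inter_univ] at h
    rw [hβ, hβ, hπ, hπ]; exact h
  have hpos' : ∀ k, t ≤ k → α k * β k ≤ γ k * π k := fun k hk => by rw [hα, hβ, hγ, hπ]; exact hpos k hk
  have hgrid := layerGrid_nonneg F.card t π α β γ hπ0 hα0 hβ0 hγ0 hαπ hβπ hπ1 mlrA mlrB hpos'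
  -- the six measures as layer sums
  have eHA : μ.real (H ∩ A) = ∑ k ∈ range (F.card + 1), if t ≤ k then α k else 0 := by
    rw [real_eq_sum_layers p F (H ∩ A)]
    exact Finset.sum_congr rfl fun k _ => by rw [hα]; exact real_threshold_inter_layer p F t k A
  have eHB : μ.real (H ∩ B) = ∑ k ∈ range (F.card + 1), if t ≤ k then β k else 0 := by
    rw [real_eq_sum_layers p F (H ∩ B)]
    exact Finset.sum_congr rfl fun k _ => by rw [hβ]; exact real_threshold_inter_layer p F t k B
  have eHAB : μ.real (H ∩ A ∩ B) = ∑ k ∈ range (F.card + 1), if t ≤ k then γ k else 0 := by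
    rw [Set.inter_assoc, real_eq_sum_layers p F (H ∩ (A ∩ B))]
    exact Finset.sum_congr rfl fun k _ => by rw [hγ]; exact real_threshold_inter_layer p F t k (A ∩ B)
  have eH : μ.real H = ∑ k ∈ range (F.card + 1), if t ≤ k then π k else 0 := by
    rw [← Set.inter_univ H, real_eq_sum_layers p F (H ∩ Set.univ)]
    refine Finset.sum_congr rfl fun k _ => ?_
    rw [hπ, real_threshold_inter_layer p F t k Set.univ, Set.univ_inter]
  have eA : μ.real A = ∑ k ∈ range (F.card + 1), α k := by
    rw [real_eq_sum_layers p F A]; exact Finset.sum_congr rfl fun k _ => (hα k).symm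
  have eB : μ.real B = ∑ k ∈ range (F.card + 1), β k := by
    rw [real_eq_sum_layers p F B]; exact Finset.sum_congr rfl fun k _ => (hβ k).symm
  rw [osN_ind_ind, ← hμ, eHA, eHB, eHAB, eH, eA, eB]
  linarith [hgrid]

omit [DecidableEq ι] in
/-- **KAHN C5 / SAHI `C₃` under the layer criterion.**  For every product measure, `F`, `t` and increasing `A, B` which are nonnegatively
correlated on every layer `{N_F = k}`, `k ≥ t`:  `0 ≤ E₃(1_{Th_t(F)}, 1_A, 1_B)`. [this work] -/
theorem sahiE3_threshold_nonneg_of_layerPos (p : ι → unitInterval) (F : Finset ι) (t : ℕ) {A B : Set (Set ι)}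
    (hA : IsUpperSet A) (hB : IsUpperSet B)
    (hpos : ∀ k, t ≤ k →
      (prodBernoulli p).real (A ∩ {ω : Set ι | (F.filter (· ∈ ω)).card = k}) *
          (prodBernoulli p).real (B ∩ {ω : Set ι | (F.filter (· ∈ ω)).card = k}) ≤
        (prodBernoulli p).real (A ∩ B ∩ {ω : Set ι | (F.filter (· ∈ ω)).card = k}) *
          (prodBernoulli p).real {ω : Set ι | (F.filter (· ∈ ω)).card = k}) :
    0 ≤ sahiE3 (prodBernoulli p) {ω : Set ι | t ≤ (F.filter (· ∈ ω)).card} A B := by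
  rw [← osT_ind_ind, osT_eq_osMp_add_osN]
  exact add_nonneg (osMp_threshold_nonneg_all p F t hA hB) (osN_threshold_nonneg_of_layerPos p F t hA hB hpos)

/-! ## §4 First instance: nested pairs -/

omit [DecidableEq ι] in
/-- **Nested pairs.**  `0 ≤ n(Th_t(F); 1_A, 1_B)` whenever `A ⊆ B` (increasing), every product measure. [this work] -/
theorem osN_threshold_nonneg_of_subset (p : ι → unitInterval) (F : Finset ι) (t : ℕ) {A B : Set (Set ι)}
    (hA : IsUpperSet A) (hB : IsUpperSet B) (hAB : A ⊆ B) :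
    0 ≤ osN p {ω : Set ι | t ≤ (F.filter (· ∈ ω)).card} (ind A) (ind B) := by
  refine osN_threshold_nonneg_of_layerPos p F t hA hB fun k _ => ?_
  rw [Set.inter_eq_left.2 hAB]
  exact mul_le_mul_of_nonneg_left (measureReal_mono Set.inter_subset_right) measureReal_nonneg

omit [DecidableEq ι] in
/-- **Kahn C5 / Sahi `C₃` for a threshold slot and a nested pair** `A ⊆ B`. [this work] -/
theorem sahiE3_threshold_nonneg_of_subset (p : ι → unitInterval) (F : Finset ι) (t : ℕ) {A B : Set (Set ι)}
    (hA : IsUpperSet A) (hB : IsUpperSet B) (hAB : A ⊆ B) :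
    0 ≤ sahiE3 (prodBernoulli p) {ω : Set ι | t ≤ (F.filter (· ∈ ω)).card} A B := by
  rw [← osT_ind_ind, osT_eq_osMp_add_osN]
  exact add_nonneg (osMp_threshold_nonneg_all p F t hA hB) (osN_threshold_nonneg_of_subset p F t hA hB hAB)

end SahiOneStep

end Summit.CriticalPhenomena.PercolationContinuityZ3.Theorems
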